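import Summits.CriticalPhenomena.PercolationContinuityZ3.Theorems.PercNearOneGluingNoHeavyLowerTailThreePointVarianceBehindCutVertex
import Summits.CriticalPhenomena.PercolationContinuityZ3.Theorems.PercNearOneGluingNoHeavyLowerTailThreePointIsoQuartic
import Summits.CriticalPhenomena.PercolationContinuityZ3.Theorems.PercNearOneGluingNoHeavyLowerTailThreePointIsoSexticPendant
import HarnessLib

/-!
# The port component of `(Q6)` passes from a cut vertex to every vertex behind it — every finite weighted graph

Support file for crux `stmt-CriticalPhenomena-4575` (`NoHeavyLowerTail`), seat `prim-facecert` gen 19 (`--supports stmt-CriticalPhenomena-4575`).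
Graph-level form of the PENDANT LEMMA of `…ThreePointIsoSexticPendant` (lead gen 115 memo
`run/shared/lean/prim/prim-l12/FROM-prim-nh-lead-4575-g115-Q6-LAW-ALGEBRA.md` §6, Theorem 1 / Corollary 4), in the cut-vertex setting of
prim-l12-p1 gen 16's `…ThreePointVarianceBehindCutVertex` (same null event, same inside/outside events, same independence lemma).

Bond percolation `μ = prodBernoulli w` on a finite vertex type `V`, arbitrary pair weights.  Isolation coordinates of three vertices `a, b` and a
PORT `h`: `Q = P(a|b|h)` (pairwise disconnected), `I_a = P(a ↮ {b,h})`, `I_b = P(b ↮ {a,h})`, `I_h = P(h ↮ {a,b})`; the PORT component of the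
sextic isolation law `(Q6)` is `Q⁶ ≤ I_h² · I_b³ · I_a³` (prim-l12-p1 gen 21 `…ThreePointIsoQuartic`, exponent `2` on the port).

**Theorem (`isoSexticPort_behindCutVertex`).**  Let `c` lie BEHIND `v` as seen from `a, b`: a vertex set `S ∋ c` with `v, a, b ∉ S` and every pair
between `S` and `V ∖ (S ∪ {v})` of weight `0` (an arbitrary two–terminal ARM `(S ∪ {v}; v, c)` hung at `v`; a pendant edge `v–c` is the case
`S = {c}`).  If the port component of `(Q6)` holds for `(a, b; v)` then it holds for `(a, b; c)`.
Proof: off the null event, `a↔b ⟺ a↔b outside S`, `a↔c ⟺ (a↔v outside S) ∧ (v↔c inside S ∪ {v})`, likewise for `b`; the inside event is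
independent of the outside ones (probability `r`), so the `(a,b;c)` isolation coordinates are the two-point mixtures
`Q' = (1−r)Z + rQ`, `I_a' = (1−r)Z + rI_a`, `I_b' = (1−r)Z + rI_b`, `I_c' = (1−r) + rI_v` (`Z = P(a ↮ b)`, `I_a + I_b = Q + Z`), and
`ThreePointIsoSexticPendant.isoSexticPort_ray` applies (`isoSexticPort_iso`).
**Theorem (`isoSexticPort_of_pieces`).**  The port component of `(Q6)` for a parallel composition at `{a,b,c}` of pieces (the setting of
prim-l12-p1's `ThreePointIsoQuartic.isoQuartic_of_pieces`: a labelling `part : V → ι`, non-terminals with different labels never joined) follows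
from the port component for every piece's cylinder probabilities (isolation coordinates multiply, `ThreePointPieces.real_isoP/real_sepP`;
`ThreePointIsoSexticPendant.isoSexticPort_prod`).
The two theorems are the graph-level closure steps (arm/pendant extension of the port, parallel composition) of the class `𝒯` of memo §6
Cor. 4: every gadget assembled from `(Q6)_port`-gadgets by these operations — towers, fans of fans, any depth — satisfies `(Q6)_port`, hence
`τ_face ≤ ½` at its port (`ThreePointIsoSexticFace.face_half_of_isoSexticPort`): tower-type constructions never cross the fixed point `½`.
-/

namespace Summit.CriticalPhenomena.PercolationContinuityZ3.Theorems.ThreePointIsoSexticPendantGraph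

open MeasureTheory Set
open Literature.Probability.Percolation Literature.Probability.LatticeModels
open Summit.CriticalPhenomena.PercolationContinuityZ3.Theorems.ThreePointVarianceCutVertex
open Summit.CriticalPhenomena.PercolationContinuityZ3.Theorems.ThreePointIsoSexticPendant
open Summit.CriticalPhenomena.PercolationContinuityZ3.Theorems.ThreePointHubEvents (real_tClosed real_tClosed_inter)
open Summit.CriticalPhenomena.PercolationContinuityZ3.Theorems.ThreePointPieces

variable {V : Type*} [Fintype V] [DecidableEq V] {ι : Type*} [Fintype ι] [DecidableEq ι]

/-- **Pendant lemma in isolation coordinates.**  If `0 ≤ Q`, `A, B ≤ Z`, `A + B = Q + Z`, `0 ≤ H ≤ 1`, `r ∈ [0,1]` and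
`Q⁶ ≤ A³·B³·H²`, then `((1−r)Z + rQ)⁶ ≤ ((1−r)Z + rA)³·((1−r)Z + rB)³·((1−r) + rH)²`
(the normalised ray theorem `isoSexticPort_ray` with `a = (Z−A)/Z`, `b = (Z−B)/Z`, `c = 1−H`, `p = r`). [this work] -/
theorem isoSexticPort_iso {Z Q A B H r : ℝ} (hQ : 0 ≤ Q) (hAZ : A ≤ Z) (hBZ : B ≤ Z) (hid : A + B = Q + Z)
    (hH0 : 0 ≤ H) (hH1 : H ≤ 1) (hr0 : 0 ≤ r) (hr1 : r ≤ 1) (h6 : Q ^ 6 ≤ A ^ 3 * B ^ 3 * H ^ 2) :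
    ((1 - r) * Z + r * Q) ^ 6 ≤ ((1 - r) * Z + r * A) ^ 3 * ((1 - r) * Z + r * B) ^ 3 * ((1 - r) + r * H) ^ 2 := by
  have hZ0 : 0 ≤ Z := by nlinarith
  rcases eq_or_lt_of_le hZ0 with hZ | hZ
  · -- `Z = 0`: then `A = B = Q = 0`
    have hA : A = 0 := by nlinarith
    have hB : B = 0 := by nlinarith
    have hQ0 : Q = 0 := by nlinarith
    rw [← hZ, hA, hB, hQ0]
    have : ((1 - r) * 0 + r * 0 : ℝ) = 0 := by ring
    rw [this]
    norm_num
  · have hZne : Z ≠ 0 := ne_of_gt hZ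
    have key := isoSexticPort_ray (a := (Z - A) / Z) (b := (Z - B) / Z) (c := 1 - H) (p := r)
      (div_nonneg (by linarith) hZ0) (div_nonneg (by linarith) hZ0) (by linarith)
      (by rw [← add_div, div_le_one hZ]; linarith) (by linarith) hr0 hr1 ?_
    · have eL : ((1 - r) * Z + r * Q) ^ 6 = Z ^ 6 * (1 - r * ((Z - A) / Z + (Z - B) / Z)) ^ 6 := by
        rw [← mul_pow]; congr 1; field_simp; linear_combination (-r) * hid
      have eR : ((1 - r) * Z + r * A) ^ 3 * ((1 - r) * Z + r * B) ^ 3 * ((1 - r) + r * H) ^ 2 =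
          Z ^ 6 * ((1 - r * ((Z - A) / Z)) ^ 3 * (1 - r * ((Z - B) / Z)) ^ 3 * (1 - r * (1 - H)) ^ 2) := by
        have e1 : (1 - r) * Z + r * A = Z * (1 - r * ((Z - A) / Z)) := by field_simp; ring
        have e2 : (1 - r) * Z + r * B = Z * (1 - r * ((Z - B) / Z)) := by field_simp; ring
        have e3 : (1 - r) + r * H = 1 - r * (1 - H) := by ring
        rw [e1, e2, e3]; ring
      rw [eL, eR]
      exact mul_le_mul_of_nonneg_left key (by positivity)
    · have e0 : 1 - ((Z - A) / Z + (Z - B) / Z) = Q / Z := by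
        field_simp; linear_combination hid
      have e1 : 1 - (Z - A) / Z = A / Z := by field_simp; ring
      have e2 : 1 - (Z - B) / Z = B / Z := by field_simp; ring
      have e3 : 1 - (1 - H) = H := by ring
      rw [e0, e1, e2, e3, div_pow, div_pow, div_pow, div_le_iff₀ (pow_pos hZ 6)]
      calc Q ^ 6 ≤ A ^ 3 * B ^ 3 * H ^ 2 := h6
        _ = A ^ 3 / Z ^ 3 * (B ^ 3 / Z ^ 3) * H ^ 2 * Z ^ 6 := by field_simp

/-- Mixture identity behind a cut vertex: if `In` is determined by the pairs inside `S ∪ {v}` and `X, Y` by the pairs outside `S`, then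
`P(X ∩ (Inᶜ ∪ Y)) = (1 − P(In))·P(X) + P(In)·P(X ∩ Y)`. [folklore] -/
theorem real_inter_compl_union (w : Sym2 V → unitInterval) {S : Finset V} {v : V} (hv : v ∉ S) {In X Y : Set (BondConfig V)}
    (hIn : DeterminedBy In (↑(pairsIn (insert v S)) : Set (Sym2 V)))
    (hX : DeterminedBy X (↑(pairsIn (Finset.univ.filter fun z => z ∉ S)) : Set (Sym2 V)))
    (hY : DeterminedBy Y (↑(pairsIn (Finset.univ.filter fun z => z ∉ S)) : Set (Sym2 V))) :
    (prodBernoulli w).real (X ∩ (Inᶜ ∪ Y)) =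
      (1 - (prodBernoulli w).real In) * (prodBernoulli w).real X + (prodBernoulli w).real In * (prodBernoulli w).real (X ∩ Y) := by
  have hind : ∀ {W : Set (BondConfig V)}, DeterminedBy W (↑(pairsIn (Finset.univ.filter fun z => z ∉ S)) : Set (Sym2 V)) →
      (prodBernoulli w).real (In ∩ W) = (prodBernoulli w).real In * (prodBernoulli w).real W :=
    fun hW => prodBernoulli_real_inter_of_determinedBy_disjoint w (disjoint_pairsIn S v hv) hIn hW
      MeasurableSet.of_discrete MeasurableSet.of_discrete
  have hsplit : X ∩ (Inᶜ ∪ Y) = (X \ In) ∪ (In ∩ (X ∩ Y)) := by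
    ext ω; simp only [mem_inter_iff, mem_union, mem_compl_iff, mem_sdiff]; tauto
  have hdisj : Disjoint (X \ In) (In ∩ (X ∩ Y)) := by
    rw [Set.disjoint_left]; rintro ω ⟨_, h1⟩ ⟨h2, _⟩; exact h1 h2
  rw [hsplit, measureReal_union hdisj MeasurableSet.of_discrete, hind (hX.inter hY)]
  have h1 := measureReal_inter_add_sdiff (μ := prodBernoulli w) (s := X) (t := In) MeasurableSet.of_discrete
  rw [Set.inter_comm, hind hX] at h1
  linarith

/-- **The port component of `(Q6)` passes from a cut vertex `v` to every vertex `c` behind it** (every finite weighted graph).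
Setting: `c ∈ S`, `v, a, b ∉ S`, all pairs between `S` and `V ∖ (S ∪ {v})` of weight `0` (the part `S ∪ {v}` is an arbitrary arm hung at `v`).
If `P(a|b|v)⁶ ≤ P(v ↮ {a,b})² · P(b ↮ {a,v})³ · P(a ↮ {b,v})³` then
`P(a|b|c)⁶ ≤ P(c ↮ {a,b})² · P(b ↮ {a,c})³ · P(a ↮ {b,c})³`. [this work] -/
theorem isoSexticPort_behindCutVertex (w : Sym2 V → unitInterval) {a b c v : V} (S : Finset V) (hc : c ∈ S) (hv : v ∉ S)
    (ha : a ∉ S) (hb : b ∉ S) (hw : ∀ u ∈ S, ∀ x, x ∉ S → x ≠ v → (w s(u, x) : ℝ) = 0)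
    (hyp : (prodBernoulli w).real ((openConn a b)ᶜ ∩ (openConn a v)ᶜ ∩ (openConn b v)ᶜ) ^ 6 ≤
      (prodBernoulli w).real ((openConn a v)ᶜ ∩ (openConn b v)ᶜ) ^ 2 *
        (prodBernoulli w).real ((openConn a b)ᶜ ∩ (openConn b v)ᶜ) ^ 3 *
          (prodBernoulli w).real ((openConn a b)ᶜ ∩ (openConn a v)ᶜ) ^ 3) :
    (prodBernoulli w).real ((openConn a b)ᶜ ∩ (openConn a c)ᶜ ∩ (openConn b c)ᶜ) ^ 6 ≤
      (prodBernoulli w).real ((openConn a c)ᶜ ∩ (openConn b c)ᶜ) ^ 2 *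
        (prodBernoulli w).real ((openConn a b)ᶜ ∩ (openConn b c)ᶜ) ^ 3 *
          (prodBernoulli w).real ((openConn a b)ᶜ ∩ (openConn a c)ᶜ) ^ 3 := by
  have hN : (prodBernoulli w).real (bad S v) = 0 := real_bad w S v hw
  set μ := prodBernoulli w with hμ
  set T := (Finset.univ.filter fun z => z ∉ S) with hT
  set AB := reachIn T a b with hAB
  set AV := reachIn T a v with hAV
  set BV := reachIn T b v with hBV
  set In := reachIn (insert v S) c v with hIn
  have hdAB : DeterminedBy AB (↑(pairsIn T) : Set (Sym2 V)) := determinedBy_reachIn T a b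
  have hdAV : DeterminedBy AV (↑(pairsIn T) : Set (Sym2 V)) := determinedBy_reachIn T a v
  have hdBV : DeterminedBy BV (↑(pairsIn T) : Set (Sym2 V)) := determinedBy_reachIn T b v
  have hdIn : DeterminedBy In (↑(pairsIn (insert v S)) : Set (Sym2 V)) := determinedBy_reachIn _ c v
  have dAB := OneLayerTwoFinger.determinedBy_compl hdAB
  have dAV := OneLayerTwoFinger.determinedBy_compl hdAV
  have dBV := OneLayerTwoFinger.determinedBy_compl hdBV
  have nul := real_inter_compl_of_null w hN
  -- pointwise dictionary off the null event
  have iab : ∀ {ω}, ω ∉ bad S v → (ω ∈ openConn a b ↔ ω ∈ AB) :=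
    fun hn => ThreePointVarianceBehindCutVertex.openConn_out_iff hv hn ha hb
  have iav : ∀ {ω}, ω ∉ bad S v → (ω ∈ openConn a v ↔ ω ∈ AV) :=
    fun hn => ThreePointVarianceBehindCutVertex.openConn_out_iff hv hn ha hv
  have ibv : ∀ {ω}, ω ∉ bad S v → (ω ∈ openConn b v ↔ ω ∈ BV) :=
    fun hn => ThreePointVarianceBehindCutVertex.openConn_out_iff hv hn hb hv
  have iac : ∀ {ω}, ω ∉ bad S v → (ω ∈ openConn a c ↔ ω ∈ AV ∧ ω ∈ In) :=
    fun hn => ThreePointVarianceBehindCutVertex.openConn_ac_iff hv hn ha hc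
  have ibc : ∀ {ω}, ω ∉ bad S v → (ω ∈ openConn b c ↔ ω ∈ BV ∧ ω ∈ In) :=
    fun hn => ThreePointVarianceBehindCutVertex.openConn_ac_iff hv hn hb hc
  -- the `(a,b;v)` coordinates are outside-event probabilities
  have gQ : μ.real ((openConn a b)ᶜ ∩ (openConn a v)ᶜ ∩ (openConn b v)ᶜ) = μ.real (ABᶜ ∩ (AVᶜ ∩ BVᶜ)) := by
    rw [← nul ((openConn a b)ᶜ ∩ (openConn a v)ᶜ ∩ (openConn b v)ᶜ), ← nul (ABᶜ ∩ (AVᶜ ∩ BVᶜ))]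
    congr 1; ext ω; simp only [mem_inter_iff, mem_compl_iff]
    constructor
    · rintro ⟨⟨⟨h1, h2⟩, h3⟩, hn⟩
      exact ⟨⟨fun h => h1 ((iab hn).2 h), fun h => h2 ((iav hn).2 h), fun h => h3 ((ibv hn).2 h)⟩, hn⟩
    · rintro ⟨⟨h1, h2, h3⟩, hn⟩
      exact ⟨⟨⟨fun h => h1 ((iab hn).1 h), fun h => h2 ((iav hn).1 h)⟩, fun h => h3 ((ibv hn).1 h)⟩, hn⟩
  have gH : μ.real ((openConn a v)ᶜ ∩ (openConn b v)ᶜ) = μ.real (AVᶜ ∩ BVᶜ) := by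
    rw [← nul ((openConn a v)ᶜ ∩ (openConn b v)ᶜ), ← nul (AVᶜ ∩ BVᶜ)]
    congr 1; ext ω; simp only [mem_inter_iff, mem_compl_iff]
    constructor
    · rintro ⟨⟨h2, h3⟩, hn⟩; exact ⟨⟨fun h => h2 ((iav hn).2 h), fun h => h3 ((ibv hn).2 h)⟩, hn⟩
    · rintro ⟨⟨h2, h3⟩, hn⟩; exact ⟨⟨fun h => h2 ((iav hn).1 h), fun h => h3 ((ibv hn).1 h)⟩, hn⟩
  have gB : μ.real ((openConn a b)ᶜ ∩ (openConn b v)ᶜ) = μ.real (ABᶜ ∩ BVᶜ) := by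
    rw [← nul ((openConn a b)ᶜ ∩ (openConn b v)ᶜ), ← nul (ABᶜ ∩ BVᶜ)]
    congr 1; ext ω; simp only [mem_inter_iff, mem_compl_iff]
    constructor
    · rintro ⟨⟨h1, h3⟩, hn⟩; exact ⟨⟨fun h => h1 ((iab hn).2 h), fun h => h3 ((ibv hn).2 h)⟩, hn⟩
    · rintro ⟨⟨h1, h3⟩, hn⟩; exact ⟨⟨fun h => h1 ((iab hn).1 h), fun h => h3 ((ibv hn).1 h)⟩, hn⟩
  have gA : μ.real ((openConn a b)ᶜ ∩ (openConn a v)ᶜ) = μ.real (ABᶜ ∩ AVᶜ) := by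
    rw [← nul ((openConn a b)ᶜ ∩ (openConn a v)ᶜ), ← nul (ABᶜ ∩ AVᶜ)]
    congr 1; ext ω; simp only [mem_inter_iff, mem_compl_iff]
    constructor
    · rintro ⟨⟨h1, h2⟩, hn⟩; exact ⟨⟨fun h => h1 ((iab hn).2 h), fun h => h2 ((iav hn).2 h)⟩, hn⟩
    · rintro ⟨⟨h1, h2⟩, hn⟩; exact ⟨⟨fun h => h1 ((iab hn).1 h), fun h => h2 ((iav hn).1 h)⟩, hn⟩
  -- the `(a,b;c)` coordinates, as events built from `In` and outside events
  have gQ' : μ.real ((openConn a b)ᶜ ∩ (openConn a c)ᶜ ∩ (openConn b c)ᶜ) = μ.real (ABᶜ ∩ (Inᶜ ∪ (AVᶜ ∩ BVᶜ))) := by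
    rw [← nul ((openConn a b)ᶜ ∩ (openConn a c)ᶜ ∩ (openConn b c)ᶜ), ← nul (ABᶜ ∩ (Inᶜ ∪ (AVᶜ ∩ BVᶜ)))]
    congr 1; ext ω; simp only [mem_inter_iff, mem_compl_iff, mem_union]
    constructor
    · rintro ⟨⟨⟨h1, h2⟩, h3⟩, hn⟩
      rw [iab hn] at h1; rw [iac hn] at h2; rw [ibc hn] at h3
      exact ⟨⟨h1, by tauto⟩, hn⟩
    · rintro ⟨⟨h1, h23⟩, hn⟩
      rw [iab hn, iac hn, ibc hn]
      exact ⟨⟨⟨h1, by tauto⟩, by tauto⟩, hn⟩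
  have gH' : μ.real ((openConn a c)ᶜ ∩ (openConn b c)ᶜ) = μ.real (univ ∩ (Inᶜ ∪ (AVᶜ ∩ BVᶜ))) := by
    rw [← nul ((openConn a c)ᶜ ∩ (openConn b c)ᶜ), ← nul (univ ∩ (Inᶜ ∪ (AVᶜ ∩ BVᶜ)))]
    congr 1; ext ω; simp only [mem_inter_iff, mem_compl_iff, mem_union, mem_univ, true_and]
    constructor
    · rintro ⟨⟨h2, h3⟩, hn⟩
      rw [iac hn] at h2; rw [ibc hn] at h3
      exact ⟨by tauto, hn⟩
    · rintro ⟨h23, hn⟩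
      rw [iac hn, ibc hn]
      exact ⟨⟨by tauto, by tauto⟩, hn⟩
  have gB' : μ.real ((openConn a b)ᶜ ∩ (openConn b c)ᶜ) = μ.real (ABᶜ ∩ (Inᶜ ∪ BVᶜ)) := by
    rw [← nul ((openConn a b)ᶜ ∩ (openConn b c)ᶜ), ← nul (ABᶜ ∩ (Inᶜ ∪ BVᶜ))]
    congr 1; ext ω; simp only [mem_inter_iff, mem_compl_iff, mem_union]
    constructor
    · rintro ⟨⟨h1, h3⟩, hn⟩
      rw [iab hn] at h1; rw [ibc hn] at h3
      exact ⟨⟨h1, by tauto⟩, hn⟩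
    · rintro ⟨⟨h1, h3⟩, hn⟩
      rw [iab hn, ibc hn]
      exact ⟨⟨h1, by tauto⟩, hn⟩
  have gA' : μ.real ((openConn a b)ᶜ ∩ (openConn a c)ᶜ) = μ.real (ABᶜ ∩ (Inᶜ ∪ AVᶜ)) := by
    rw [← nul ((openConn a b)ᶜ ∩ (openConn a c)ᶜ), ← nul (ABᶜ ∩ (Inᶜ ∪ AVᶜ))]
    congr 1; ext ω; simp only [mem_inter_iff, mem_compl_iff, mem_union]
    constructor
    · rintro ⟨⟨h1, h2⟩, hn⟩
      rw [iab hn] at h1; rw [iac hn] at h2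
      exact ⟨⟨h1, by tauto⟩, hn⟩
    · rintro ⟨⟨h1, h2⟩, hn⟩
      rw [iab hn, iac hn]
      exact ⟨⟨h1, by tauto⟩, hn⟩
  -- mixture identities
  have hduniv : DeterminedBy (univ : Set (BondConfig V)) (↑(pairsIn T) : Set (Sym2 V)) := by
    rw [determinedBy_iff]; intro ω ω' _; simp
  set r := μ.real In with hr
  set Z := μ.real ABᶜ with hZ
  set Q := μ.real (ABᶜ ∩ (AVᶜ ∩ BVᶜ)) with hQ
  set IA := μ.real (ABᶜ ∩ AVᶜ) with hIA
  set IB := μ.real (ABᶜ ∩ BVᶜ) with hIB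
  set IH := μ.real (AVᶜ ∩ BVᶜ) with hIH
  have mQ : μ.real (ABᶜ ∩ (Inᶜ ∪ (AVᶜ ∩ BVᶜ))) = (1 - r) * Z + r * Q :=
    real_inter_compl_union w hv hdIn dAB (dAV.inter dBV)
  have mH : μ.real (univ ∩ (Inᶜ ∪ (AVᶜ ∩ BVᶜ))) = (1 - r) + r * IH := by
    rw [real_inter_compl_union w hv hdIn hduniv (dAV.inter dBV), probReal_univ, univ_inter]; ring
  have mB : μ.real (ABᶜ ∩ (Inᶜ ∪ BVᶜ)) = (1 - r) * Z + r * IB := real_inter_compl_union w hv hdIn dAB dBV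
  have mA : μ.real (ABᶜ ∩ (Inᶜ ∪ AVᶜ)) = (1 - r) * Z + r * IA := real_inter_compl_union w hv hdIn dAB dAV
  rw [gQ', gH', gB', gA', mQ, mH, mB, mA]
  rw [gQ, gH, gB, gA] at hyp
  -- the identity `IA + IB = Q + Z` (`a↔v ∧ b↔v ⟹ a↔b` outside `S`)
  have hcup : ABᶜ ∩ AVᶜ ∪ ABᶜ ∩ BVᶜ = ABᶜ := by
    ext ω; simp only [mem_union, mem_inter_iff, mem_compl_iff]
    constructor
    · rintro (⟨h, _⟩ | ⟨h, _⟩) <;> exact h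
    · intro h
      by_cases hav : ω ∈ AV
      · right; exact ⟨h, fun hbv => h (show ω ∈ AB from SimpleGraph.Reachable.trans hav (SimpleGraph.Reachable.symm hbv))⟩
      · left; exact ⟨h, hav⟩
  have hid : IA + IB = Q + Z := by
    have h1 := measureReal_union_add_inter (μ := μ) (s := ABᶜ ∩ AVᶜ) (t := ABᶜ ∩ BVᶜ) MeasurableSet.of_discrete
    rw [hcup, show ABᶜ ∩ AVᶜ ∩ (ABᶜ ∩ BVᶜ) = ABᶜ ∩ (AVᶜ ∩ BVᶜ) by ext ω; simp only [mem_inter_iff]; tauto] at h1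
    linarith
  have key := isoSexticPort_iso (r := r) measureReal_nonneg (measureReal_mono fun ω h => h.1) (measureReal_mono fun ω h => h.1)
    hid measureReal_nonneg measureReal_le_one measureReal_nonneg measureReal_le_one
    (by calc Q ^ 6 ≤ IH ^ 2 * IB ^ 3 * IA ^ 3 := hyp
      _ = IA ^ 3 * IB ^ 3 * IH ^ 2 := by ring)
  calc ((1 - r) * Z + r * Q) ^ 6 ≤ ((1 - r) * Z + r * IA) ^ 3 * ((1 - r) * Z + r * IB) ^ 3 * ((1 - r) + r * IH) ^ 2 := key
    _ = ((1 - r) + r * IH) ^ 2 * ((1 - r) * Z + r * IB) ^ 3 * ((1 - r) * Z + r * IA) ^ 3 := by ring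

/-! ## Parallel composition at the three terminals -/

/-- **The port component of `(Q6)` for parallel compositions** (setting of `ThreePointIsoQuartic.isoQuartic_of_pieces`): if every piece `i`
satisfies `Qᵢ⁶ ≤ Aᵢ²·Bᵢ³·Cᵢ³` for its cylinder probabilities `Qᵢ = P(a|b|c inside i)`, `Aᵢ = P(c isolated inside i)`, `Bᵢ = P(b isolated inside i)`,
`Cᵢ = P(a isolated inside i)`, then `P(a|b|c)⁶ ≤ P(c ↮ {a,b})² · P(b ↮ {a,c})³ · P(a ↮ {b,c})³`. [this work] -/
theorem isoSexticPort_of_pieces (w : Sym2 V → unitInterval) {a b c : V} (hab : a ≠ b) (hac : a ≠ c) (hbc : b ≠ c)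
    (part : V → ι) (hw : ∀ u v : V, u ∉ terms a b c → v ∉ terms a b c → part u ≠ part v → (w s(u, v) : ℝ) = 0)
    (h6 : ∀ i, (prodBernoulli w).real (isoPiece (piecePairs a b c part i) a b c ∩ isoPiece (piecePairs a b c part i) b a c) ^ 6 ≤
      (prodBernoulli w).real (isoPiece (piecePairs a b c part i) c a b) ^ 2 *
        (prodBernoulli w).real (isoPiece (piecePairs a b c part i) b a c) ^ 3 *
          (prodBernoulli w).real (isoPiece (piecePairs a b c part i) a b c) ^ 3) :
    (prodBernoulli w).real ((openConn a b)ᶜ ∩ (openConn a c)ᶜ ∩ (openConn b c)ᶜ) ^ 6 ≤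
      (prodBernoulli w).real ((openConn a c)ᶜ ∩ (openConn b c)ᶜ) ^ 2 *
        (prodBernoulli w).real ((openConn a b)ᶜ ∩ (openConn b c)ᶜ) ^ 3 *
          (prodBernoulli w).real ((openConn a b)ᶜ ∩ (openConn a c)ᶜ) ^ 3 := by
  have hN : (prodBernoulli w).real (badP a b c part) = 0 := real_badP w a b c part hw
  set μ := prodBernoulli w with hμ
  set IA : Set (BondConfig V) := (openConn a b)ᶜ ∩ (openConn a c)ᶜ with hIA
  set IB : Set (BondConfig V) := (openConn a b)ᶜ ∩ (openConn b c)ᶜ with hIB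
  set IC : Set (BondConfig V) := (openConn a c)ᶜ ∩ (openConn b c)ᶜ with hIC
  have hsep : (openConn a b)ᶜ ∩ (openConn a c)ᶜ ∩ (openConn b c)ᶜ = IA ∩ IB := by
    ext ω
    simp only [hIA, hIB, mem_inter_iff, mem_compl_iff]
    tauto
  rw [hsep]
  set F : ι → Finset (Sym2 V) := fun i => piecePairs a b c part i with hF
  set PQ : ℝ := ∏ i ∈ (Finset.univ : Finset ι), μ.real (isoPiece (F i) a b c ∩ isoPiece (F i) b a c) with hPQ
  set PA : ℝ := ∏ i ∈ (Finset.univ : Finset ι), μ.real (isoPiece (F i) c a b) with hPA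
  set PB : ℝ := ∏ i ∈ (Finset.univ : Finset ι), μ.real (isoPiece (F i) b a c) with hPB
  set PC : ℝ := ∏ i ∈ (Finset.univ : Finset ι), μ.real (isoPiece (F i) a b c) with hPC
  set pab : ℝ := (w s(a, b) : ℝ)
  set pac : ℝ := (w s(a, c) : ℝ)
  set pbc : ℝ := (w s(b, c) : ℝ)
  have hpab : 0 ≤ 1 - pab := sub_nonneg.2 (unitInterval.le_one _)
  have hpac : 0 ≤ 1 - pac := sub_nonneg.2 (unitInterval.le_one _)
  have hpbc : 0 ≤ 1 - pbc := sub_nonneg.2 (unitInterval.le_one _)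
  have hpac1 : 1 - pac ≤ 1 := sub_le_self _ (unitInterval.nonneg _)
  have hpbc1 : 1 - pbc ≤ 1 := sub_le_self _ (unitInterval.nonneg _)
  have eQ : μ.real (IA ∩ IB) = (1 - pab) * (1 - pac) * (1 - pbc) * PQ := by
    rw [hIA, hIB, hμ, real_sepP' w part hab hac hbc hN, real_sepP, real_tClosed_inter w hab hac hbc]
  have eA : μ.real IC = (1 - pac) * (1 - pbc) * PA := by
    rw [hIC, hμ, real_isoPc w part hac hbc hN, real_isoP w a b c part (mem_terms.2 (Or.inr (Or.inr rfl))) (mem_terms.2 (Or.inl rfl))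
      (mem_terms.2 (Or.inr (Or.inl rfl))), real_tClosed w hab, Sym2.eq_swap (a := c) (b := a), Sym2.eq_swap (a := c) (b := b)]
  have eB : μ.real IB = (1 - pab) * (1 - pbc) * PB := by
    rw [hIB, hμ, real_isoPb w part hab hbc hN, real_isoP w a b c part (mem_terms.2 (Or.inr (Or.inl rfl))) (mem_terms.2 (Or.inl rfl))
      (mem_terms.2 (Or.inr (Or.inr rfl))), real_tClosed w hac, Sym2.eq_swap (a := b) (b := a)]
  have eC : μ.real IA = (1 - pab) * (1 - pac) * PC := by
    rw [hIA, hμ, real_isoPa w part hab hac hN, real_isoP w a b c part (mem_terms.2 (Or.inl rfl)) (mem_terms.2 (Or.inr (Or.inl rfl)))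
      (mem_terms.2 (Or.inr (Or.inr rfl))), real_tClosed w hbc]
  have hPQnn : 0 ≤ PQ := Finset.prod_nonneg fun _ _ => measureReal_nonneg
  have hprod : PQ ^ 6 ≤ PC ^ 3 * PB ^ 3 * PA ^ 2 :=
    isoSexticPort_prod Finset.univ _ _ _ _ (fun _ _ => measureReal_nonneg) fun i _ => (h6 i).trans_eq (by ring)
  have hcoef : ((1 - pab) * (1 - pac) * (1 - pbc)) ^ 6 ≤ (1 - pab) ^ 6 * (1 - pac) ^ 5 * (1 - pbc) ^ 5 := by
    have h1 : (1 - pac) ^ 6 ≤ (1 - pac) ^ 5 := pow_le_pow_of_le_one hpac hpac1 (by norm_num)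
    have h2 : (1 - pbc) ^ 6 ≤ (1 - pbc) ^ 5 := pow_le_pow_of_le_one hpbc hpbc1 (by norm_num)
    calc ((1 - pab) * (1 - pac) * (1 - pbc)) ^ 6 = (1 - pab) ^ 6 * ((1 - pac) ^ 6 * (1 - pbc) ^ 6) := by ring
      _ ≤ (1 - pab) ^ 6 * ((1 - pac) ^ 5 * (1 - pbc) ^ 5) :=
          mul_le_mul_of_nonneg_left (mul_le_mul h1 h2 (pow_nonneg hpbc 6) (pow_nonneg hpac 5)) (pow_nonneg hpab 6)
      _ = (1 - pab) ^ 6 * (1 - pac) ^ 5 * (1 - pbc) ^ 5 := by ring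
  rw [eQ, eA, eB, eC]
  calc ((1 - pab) * (1 - pac) * (1 - pbc) * PQ) ^ 6 = ((1 - pab) * (1 - pac) * (1 - pbc)) ^ 6 * PQ ^ 6 := by ring
    _ ≤ ((1 - pab) ^ 6 * (1 - pac) ^ 5 * (1 - pbc) ^ 5) * (PC ^ 3 * PB ^ 3 * PA ^ 2) :=
        mul_le_mul hcoef hprod (pow_nonneg hPQnn 6) (by positivity)
    _ = ((1 - pac) * (1 - pbc) * PA) ^ 2 * ((1 - pab) * (1 - pbc) * PB) ^ 3 * ((1 - pab) * (1 - pac) * PC) ^ 3 := by ring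

end Summit.CriticalPhenomena.PercolationContinuityZ3.Theorems.ThreePointIsoSexticPendantGraph
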